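import Mathlib
import HarnessLib
import Literature.MathematicalPhysics.QuantumLattice.FermiRG.BGM2003Sectors
import Literature.MathematicalPhysics.QuantumLattice.AnisotropicSectors
import Literature.MathematicalPhysics.QuantumLattice.SectorSymbolMasterZero
import Summits.HubbardSuperconductivity.HubbardSuperconductivity.Theorems.KLProgrammeFermiSurfaceEnvelope

/-!
# Route `KLProgramme` (crux K1 `H10TwoPointLimit` = BGM at intermediate filling; also K3): the
# Benfatto–Giuliani–Mastropietro 2003 dispersion hypotheses, as TYPED in `FermiRG/BGM2003Sectors.lean`,
# hold for the Hubbard band on every closed shell inside `-4 < μ < 0`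

Cell `gate-hubbard-kl`, risk-register item r2. The typer file `BGM2003Sectors.lean` (t3) states BGM 2003 §1.2
(2.8a)–(2.8c) as the predicate `FermiRG.BGM2003.DispersionHyp ε μ e₀ u` on a dispersion `ε : ℝ² → ℝ`, a
chemical potential `μ`, a shell width `e₀` and the polar radius `u(θ, e)` of the level curves
`Σ(e) = {ε = μ + e}`, and says: «the Hubbard band dispersion satisfies them for `-4 < μ < 0` by the tree's
`HubbardFermiBandCurvature` / `HubbardFermiRadiusBand*`; that instantiation is fs-1's theorem». Here it is:
for `ε = sqDispersion` (`-2 (cos k₁ + cos k₂)`) and `u θ e = bandFermiRadius (μ + e) θ`,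

  `DispersionHyp sqDispersion μ e₀ u` whenever `0 < e₀`, `-4 < μ - e₀`, `μ + e₀ < 0`

(`klfs_bgm2003_dispersionHyp`): smoothness of `ε` and joint smoothness of `u` (tree, implicit function
theorem), `u ≥ √(μ - e₀ + 4)`, the level property, CONVEXITY with the closed-form constant
`1/r(θ,e) ≥ -(μ + e₀)/√32` (BGM's curvature `(u² + 2u'² - u u'')/s'³` IS the polar curvature of
`KLProgrammeFermiSurfaceEnvelope`, `klfs_bgmCurvature_eq`, whose envelope gives the bound), radial
transversality `c₁ ≤ ∇ε·e⃗_r ≤ 4` with `c₁ = cDtmin (μ - e₀) (μ + e₀)` of the tree's `BandBounds`, symmetry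
and the antipodal property `u(θ + π, e) = u(θ, e)`. In particular on the certified window
(`klfs_window_bgm2003_dispersionHyp`, `e₀ = 0.08`) and on the analysis window `[-1, -0.15]`
(`klfs_analysisWindow_bgm2003_dispersionHyp`, `e₀ = 0.07`). No definitions; everything PROVED. [folklore]
-/

noncomputable section

open Real Set

-- the tree's namespace `Summit.<Summit>.<Problem>.Theorems` repeats the summit name by design (D-0017)
set_option linter.dupNamespace false

namespace Summit.HubbardSuperconductivity.HubbardSuperconductivity.Theorems

open Literature.MathematicalPhysics.QuantumLattice

/-! ### §1 The polar radius `u(θ, e) = u_{μ+e}(θ)` in BGM's vocabulary -/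

/-- `u_μ(θ + 2π) = u_μ(θ)` for EVERY `μ` (also outside the band, where `bandFermiRadius` is a junk value:
the defining predicate is `2π`-periodic in the angle). [folklore] -/
theorem klfs_bandFermiRadius_add_two_pi_all (μ θ : ℝ) : bandFermiRadius μ (θ + 2 * π) = bandFermiRadius μ θ := by
  have h : IsBandFermiRadius μ (θ + 2 * π) = IsBandFermiRadius μ θ := by
    funext t
    simp only [IsBandFermiRadius, norm_dir, rayDispersion_eq, Real.cos_add_two_pi, Real.sin_add_two_pi]
  unfold bandFermiRadius
  rw [h]

/-- BGM's `u'(θ, e)` is the tree's `bandFermiRadiusDeriv (μ + e)`. [folklore] -/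
theorem klfs_radiusDeriv_eq {μ e : ℝ} (h₁ : -4 < μ + e) (h₂ : μ + e < 0) (θ : ℝ) :
    FermiRG.BGM2003.radiusDeriv (fun ϑ e' => bandFermiRadius (μ + e') ϑ) θ e = bandFermiRadiusDeriv (μ + e) θ := by
  unfold FermiRG.BGM2003.radiusDeriv
  exact deriv_bandFermiRadius h₁ h₂ θ

/-- BGM's `u''(θ, e)` is the tree's `bandRadiusDeriv2 (μ + e)`. [folklore] -/
theorem klfs_radiusDeriv₂_eq {μ e : ℝ} (h₁ : -4 < μ + e) (h₂ : μ + e < 0) (θ : ℝ) :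
    FermiRG.BGM2003.radiusDeriv₂ (fun ϑ e' => bandFermiRadius (μ + e') ϑ) θ e = bandRadiusDeriv2 (μ + e) θ := by
  unfold FermiRG.BGM2003.radiusDeriv₂ bandRadiusDeriv2
  have hfun : (fun ϑ => FermiRG.BGM2003.radiusDeriv (fun ϑ e' => bandFermiRadius (μ + e') ϑ) ϑ e) =
      bandFermiRadiusDeriv (μ + e) := funext fun ϑ => klfs_radiusDeriv_eq h₁ h₂ ϑ
  rw [hfun]

/-- BGM's speed `s'(θ,e) = √(u'² + u²)` is `√(x'² + y'²)` of the tree's band curve. [folklore] -/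
theorem klfs_speed_eq {μ e : ℝ} (h₁ : -4 < μ + e) (h₂ : μ + e < 0) (θ : ℝ) :
    FermiRG.BGM2003.speed (fun ϑ e' => bandFermiRadius (μ + e') ϑ) θ e =
      Real.sqrt (bandVX (μ + e) θ ^ 2 + bandVY (μ + e) θ ^ 2) := by
  unfold FermiRG.BGM2003.speed
  rw [klfs_radiusDeriv_eq h₁ h₂, BandSectorCounting.bandVX_sq_add_bandVY_sq]

/-- **BGM's curvature `1/r(θ,e) = (u² + 2u'² - u u'')/s'³` IS the polar curvature `(x'y'' - y'x'')/|p'|³`**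
of the tree's band curve at level `μ + e` (`bandCross_eq_polar`). [folklore] -/
theorem klfs_bgmCurvature_eq {μ e : ℝ} (h₁ : -4 < μ + e) (h₂ : μ + e < 0) (θ : ℝ) :
    FermiRG.BGM2003.curvature (fun ϑ e' => bandFermiRadius (μ + e') ϑ) θ e =
      (bandVX (μ + e) θ * bandAY (μ + e) θ - bandVY (μ + e) θ * bandAX (μ + e) θ) /
        ((bandVX (μ + e) θ ^ 2 + bandVY (μ + e) θ ^ 2) *
          Real.sqrt (bandVX (μ + e) θ ^ 2 + bandVY (μ + e) θ ^ 2)) := by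
  unfold FermiRG.BGM2003.curvature
  rw [klfs_speed_eq h₁ h₂, klfs_radiusDeriv_eq h₁ h₂, klfs_radiusDeriv₂_eq h₁ h₂, bandCross_eq_polar]
  have hV : 0 ≤ bandVX (μ + e) θ ^ 2 + bandVY (μ + e) θ ^ 2 := by positivity
  have h3 : Real.sqrt (bandVX (μ + e) θ ^ 2 + bandVY (μ + e) θ ^ 2) ^ 3 =
      (bandVX (μ + e) θ ^ 2 + bandVY (μ + e) θ ^ 2) * Real.sqrt (bandVX (μ + e) θ ^ 2 + bandVY (μ + e) θ ^ 2) := by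
    rw [pow_succ, Real.sq_sqrt hV]
  rw [h3]

/-- **Convexity with the closed-form constant**: `1/r(θ,e) ≥ -(μ+e)/√(32 - 2(μ+e)²)` (the nodal curvature
of the level `μ + e`). [folklore] -/
theorem klfs_bgmCurvature_ge {μ e : ℝ} (h₁ : -4 < μ + e) (h₂ : μ + e < 0) (θ : ℝ) :
    -(μ + e) / Real.sqrt (32 - 2 * (μ + e) ^ 2) ≤
      FermiRG.BGM2003.curvature (fun ϑ e' => bandFermiRadius (μ + e') ϑ) θ e := by
  rw [klfs_bgmCurvature_eq h₁ h₂]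
  exact (klfs_polarCurvature_mem_Icc h₁ h₂ θ).1

/-- **The radial derivative `∇ε(p⃗)·e⃗_r(θ)` at the level point is the tree's `∂_t F(θ, u)`**
(`rayDispersionDt`). [folklore] -/
theorem klfs_fderiv_sqDispersion_levelPoint (μ e θ : ℝ) :
    fderiv ℝ sqDispersion (FermiRG.BGM2003.levelPoint (fun ϑ e' => bandFermiRadius (μ + e') ϑ) θ e) (dir θ) =
      rayDispersionDt θ (bandFermiRadius (μ + e) θ) := by
  rw [fderiv_sqDispersion_apply, FermiRG.BGM2003.levelPoint, rayDispersionDt]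
  simp [dir, smul_eq_mul]
  ring

/-- `∂_t F(θ, t) ≤ 4`. [folklore] -/
theorem klfs_rayDispersionDt_le_four (θ t : ℝ) : rayDispersionDt θ t ≤ 4 := by
  rw [rayDispersionDt]
  have h1 := Real.abs_cos_le_one θ; have h2 := Real.abs_sin_le_one θ
  have h3 := Real.abs_sin_le_one (t * Real.cos θ); have h4 := Real.abs_sin_le_one (t * Real.sin θ)
  have hm1 : Real.cos θ * Real.sin (t * Real.cos θ) ≤ 1 := by
    have := abs_mul (Real.cos θ) (Real.sin (t * Real.cos θ))
    nlinarith [le_abs_self (Real.cos θ * Real.sin (t * Real.cos θ)), abs_nonneg (Real.cos θ),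
      abs_nonneg (Real.sin (t * Real.cos θ)), mul_le_mul h1 h3 (abs_nonneg _) zero_le_one]
  have hm2 : Real.sin θ * Real.sin (t * Real.sin θ) ≤ 1 := by
    have := abs_mul (Real.sin θ) (Real.sin (t * Real.sin θ))
    nlinarith [le_abs_self (Real.sin θ * Real.sin (t * Real.sin θ)), abs_nonneg (Real.sin θ),
      abs_nonneg (Real.sin (t * Real.sin θ)), mul_le_mul h2 h4 (abs_nonneg _) zero_le_one]
  linarith

/-! ### §2 The hypotheses of BGM 2003 §1.2 for the Hubbard band -/

/-- **BGM 2003's dispersion hypotheses (2.8a)–(2.8c) HOLD for the Hubbard band on every closed shell inside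
the band**: for `0 < e₀`, `-4 < μ - e₀`, `μ + e₀ < 0`,
`DispersionHyp sqDispersion μ e₀ (fun θ e ↦ bandFermiRadius (μ + e) θ)` — with the constants
`u ≥ √(μ - e₀ + 4)`, `1/r ≥ -(μ + e₀)/√32`, `cDtmin (μ - e₀) (μ + e₀) ≤ ∇ε·e⃗_r ≤ 4`. BGM's own range is
`μ < -2 - √2`; this is the intermediate-filling extension K1 needs. [folklore] -/
theorem klfs_bgm2003_dispersionHyp {μ e₀ : ℝ} (he₀ : 0 < e₀) (h₁ : -4 < μ - e₀) (h₂ : μ + e₀ < 0) :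
    FermiRG.BGM2003.DispersionHyp sqDispersion μ e₀ (fun θ e => bandFermiRadius (μ + e) θ) := by
  have hlev : ∀ e : ℝ, |e| ≤ e₀ → -4 < μ + e ∧ μ + e < 0 := fun e he => by
    have h := abs_le.1 he; exact ⟨by linarith [h.1], by linarith [h.2]⟩
  have hab : μ - e₀ ≤ μ + e₀ := by linarith
  refine
    { e₀_pos := he₀
      smooth_ε := contDiff_sqDispersion
      smooth_u := ?_
      periodic_u := fun e θ => klfs_bandFermiRadius_add_two_pi_all (μ + e) θ
      u_pos := ?_
      level := fun θ e he => ?_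
      convex := ?_
      radial := ?_
      symm := klfs_sqDispersion_neg
      antipodal := fun θ e he => bandFermiRadius_add_pi (hlev e he).1 (hlev e he).2 θ }
  · -- joint smoothness on a slightly larger open shell
    set m := min (μ + 4) (-μ) with hm
    have hme : e₀ < m := lt_min (by linarith) (by linarith)
    refine ⟨(e₀ + m) / 2, by linarith, ?_⟩
    have hg : ContDiff ℝ ((⊤ : ℕ∞) : WithTop ℕ∞) (fun p : ℝ × ℝ => ((μ + p.2, p.1) : ℝ × ℝ)) :=
      (contDiff_const.add contDiff_snd).prodMk contDiff_fst
    have hmaps : MapsTo (fun p : ℝ × ℝ => ((μ + p.2, p.1) : ℝ × ℝ)) (univ ×ˢ Ioo (-((e₀ + m) / 2)) ((e₀ + m) / 2))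
        (Ioo (-4 : ℝ) 0 ×ˢ univ) := by
      intro p hp
      obtain ⟨-, hp2⟩ := hp
      have hm1 : m ≤ μ + 4 := min_le_left _ _
      have hm2 : m ≤ -μ := min_le_right _ _
      exact ⟨⟨by linarith [hp2.1], by linarith [hp2.2]⟩, mem_univ _⟩
    have h := contDiffOn_bandFermiRadius_uncurry.comp hg.contDiffOn hmaps
    exact h
  · refine ⟨Real.sqrt (μ - e₀ + 4), Real.sqrt_pos.2 (by linarith), fun θ e he => ?_⟩
    obtain ⟨ha, hb⟩ := hlev e he
    have h := abs_le.1 he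
    exact (Real.sqrt_le_sqrt (by linarith [h.1])).trans (BandSectorCounting.sqrt_le_bandFermiRadius ha hb θ)
  · obtain ⟨ha, hb⟩ := hlev e he
    show sqDispersion (bandFermiRadius (μ + e) θ • dir θ) = μ + e
    exact sqDispersion_bandFermiRadius ha hb θ
  · refine ⟨-(μ + e₀) / Real.sqrt 32, div_pos (by linarith) (by positivity), fun θ e he => ?_⟩
    obtain ⟨ha, hb⟩ := hlev e he
    have h := abs_le.1 he
    refine le_trans ?_ (klfs_bgmCurvature_ge ha hb θ)
    have hs : Real.sqrt (32 - 2 * (μ + e) ^ 2) ≤ Real.sqrt 32 := Real.sqrt_le_sqrt (by nlinarith)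
    have hspos : 0 < Real.sqrt (32 - 2 * (μ + e) ^ 2) := Real.sqrt_pos.2 (by nlinarith)
    have h32 : 0 < Real.sqrt 32 := by positivity
    rw [div_le_div_iff₀ h32 hspos]
    nlinarith [mul_le_mul_of_nonneg_left hs (show 0 ≤ -(μ + e) by linarith)]
  · refine ⟨BandSectorCounting.cDtmin (μ - e₀) (μ + e₀), 4, ?_, ?_, fun θ e he => ?_⟩
    · have hq := BandSectorCounting.cQ_pos h₁ hab h₂
      have hu := BandSectorCounting.cUmin_pos h₁
      show 0 < 2 * BandSectorCounting.cQ (μ + e₀) * BandSectorCounting.cUmin (μ - e₀)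
      positivity
    · have h := BandSectorCounting.cDtmin_le h₁ hab h₂ (μ := μ) ⟨by linarith, by linarith⟩ 0
      exact h.trans (klfs_rayDispersionDt_le_four 0 _)
    · rw [klfs_fderiv_sqDispersion_levelPoint]
      have h := abs_le.1 he
      exact ⟨BandSectorCounting.cDtmin_le h₁ hab h₂ ⟨by linarith [h.1], by linarith [h.2]⟩ θ,
        klfs_rayDispersionDt_le_four θ _⟩

/-- **On the certified window** `μ ∈ [-0.4267, -0.1798]` (image of `δ ∈ [0.10, 0.20]`): BGM 2003's
hypotheses hold with shell width `e₀ = 0.08`. [folklore] -/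
theorem klfs_window_bgm2003_dispersionHyp {μ : ℝ} (hμ : μ ∈ Icc (-0.4267 : ℝ) (-0.1798)) :
    FermiRG.BGM2003.DispersionHyp sqDispersion μ 0.08 (fun θ e => bandFermiRadius (μ + e) θ) :=
  klfs_bgm2003_dispersionHyp (by norm_num) (by linarith [hμ.1]) (by linarith [hμ.2])

/-- **On the analysis window** `μ ∈ [-1, -0.15]` of K1/K3: BGM 2003's hypotheses hold with shell width
`e₀ = 0.07`. [folklore] -/
theorem klfs_analysisWindow_bgm2003_dispersionHyp {μ : ℝ} (hμ : μ ∈ Icc (-1 : ℝ) (-0.15)) :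
    FermiRG.BGM2003.DispersionHyp sqDispersion μ 0.07 (fun θ e => bandFermiRadius (μ + e) θ) :=
  klfs_bgm2003_dispersionHyp (by norm_num) (by linarith [hμ.1]) (by linarith [hμ.2])

end Summit.HubbardSuperconductivity.HubbardSuperconductivity.Theorems

end
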